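import Literature.Probability.LatticeModels.SRWReturnCounts
import Literature.Probability.LatticeModels.LatticeGreenFunction
import Mathlib.Analysis.SpecialFunctions.Gaussian.GaussianIntegral
import Mathlib.Analysis.SpecialFunctions.Integrals.Basic
import Mathlib.MeasureTheory.Integral.Pi
import Mathlib.Analysis.PSeries
import HarnessLib

/-!
# Return probabilities of the simple random walk on `ℤ^d`: Fourier representation and the
# `m^{-d/2}` bound

Companion to `SRWStepSequences.lean` / `SRWReturnCounts.lean` (namespace
`Literature.Probability.LatticeModels.SRW`). For the simple random walk `S` on `ℤ^d`,
`pₘ(0) = P(Sₘ = 0) = prob d m 0`, we prove the classical Fourier formula and the on-diagonal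
heat-kernel upper bound (Spitzer 1976, P7.9; Lawler–Limic 2010, §2.4 and Prop. 2.4.4 give the
sharp local limit theorem; here only the upper bound, by an elementary argument):

* `integral_brillouin_cexp_phase` — orthogonality `∫_{[-π,π]^d} e^{iθ·x} dθ = (2π)^d [x = 0]`;
* `count_zero_eq_integral` / `prob_eq_integral` —
  `pₘ(0) = (2π)^{-d} ∫_{[-π,π]^d} (d⁻¹ Σⱼ cos θⱼ)^m dθ` (expand `(Σ_v e^{iθ·e_v})^m` over step
  sequences, `Finset.sum_pow'`, and integrate term by term);
* `abs_avg_cos_pow_le` — on the Brillouin zone,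
  `|d⁻¹ Σⱼ cos θⱼ|^m ≤ e^{-mc Σ θⱼ²} + e^{-mc Σ (π - |θⱼ|)²}`, `c = 2/(dπ²)` (Jordan's inequality
  `1 - cos t ≥ (2/π²)t²` on `[-π,π]`, Mathlib `Real.cos_le_one_sub_mul_cos_sq`, at `t` and at
  `π - |t|`);
* `prob_le_inv_sqrt_pow` — **`pₘ(0) ≤ C_d m^{-d/2}`** for `m ≥ 1`, with the explicit
  `C_d = (2π)^{-d} (1 + 2^d) (dπ³/2)^{d/2}` (Gaussian integrals, Mathlib `integral_gaussian`).

The Brillouin zone `brillouin d = [-π,π]^d` and Jordan's bound are those of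
`LatticeGreenFunction.lean`. Fully proved, all `d ≥ 1`.

**Prior art in the tree (disclosure; to be identified/retargeted in the librarian refactor
announced in `SRWReturnCounts.lean`).** Except for the explicit constant `C_d`, the uniform-in-`x`
bound `prob_four_le` and the tail/partial-sum bounds (`green4_tail_le`, `green4_sub_partial_le`),
every theorem of this file already exists in `Literature` on another encoding of `pₙ(x)`:
(i) `Literature.Barriers.CriticalPhenomena.CTWSAW.prob_eq_integral` (all `x`, `d ≥ 1`),
`summable_prob_zero` (every `d ≥ 3`), `one_le_tsum_prob_zero`, `tsum_prob_zero_le`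
(`Barriers/CriticalPhenomena/WeaklySAWReturnProbability.lean`), on the encoding
`card ((zdGraph d).finsetWalkLength n 0 x)/(2d)^n`, which is `SRW.prob d n x` up to the single
rewrite `SRW.card_finsetWalkLength_eq_count`;
(ii) `Literature.Barriers.CriticalPhenomena.LongRangePhi4.exists_srwLaw_le_rpow`
(`pₙ(x) ≤ K n^{-d/2}`, all `x`, `n ≥ 1`, `d ≥ 1`) and `lazyLaw_zero_le` (explicit constant for the
lazy walk) (`Barriers/CriticalPhenomena/RigorousRGSmallParameterLazyWalk.lean`), on the `srwLaw`
encoding listed for retargeting in `SRWReturnCounts.lean`.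
The delta of the present file is the placement in the lower `Probability/LatticeModels` layer on
`SRW.prob`, the explicit `C_d`, `prob_four_le` and `green4_sub_partial_le`; its statements should
become the retargeting targets (or be replaced by) the declarations (i)–(ii) in that refactor.
The phase `phase θ x = Σⱼ θⱼ xⱼ` is byte-for-byte `Literature.Barriers.CriticalPhenomena.kdot`
(`GaussianDominationRoute.lean`; `phase θ x = kdot θ x` is `rfl`), which carries the tree's
orthogonality/continuity API (`integral_cube_cos_kdot`, `kdot_sub`, …) and is to be retargeted onto
`phase` (or conversely) in the same refactor; it is also `rfl`-equal to Mathlib's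
`θ ⬝ᵥ (fun j => (x j : ℝ))` (`phase_eq_dotProduct`), is literally the argument of the cosine in
the integrand of `latticeGreen`, and equals `-(2π) • phaseFunctional x θ`
(`LatticeGreenFunction.lean`).

**Other encodings of the Green function at the origin in the tree.** The real number
`green4 = Σ'ₘ pₘ(0)` (`d = 4`, expected number of visits to `0`, time `0` included) defined at the
end of this file is, up to explicit factors, already present four times:
(a) `latticeGreen (0 : Site 4)` (`LatticeGreenFunction.lean`, imported here) is `d⁻¹ Σₙ P(Sₙ = 0)`
by its docstring, so `green4 = 4 * latticeGreen 0` — the identification needs the Fourier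
inversion `Σₘ ∫ φ^m = ∫ (1-φ)⁻¹` on `[-π,π]^4` (monotone convergence against
`integrable_indicator_inv_dispersion`) and is deferred to a glue lemma (not needed by the present
users, who only use `green4` through the bounds of this file);
(b) `Literature.Barriers.CriticalPhenomena.SpreadOutIsing.srwGreen d x = Σ' convPow (srwStep d) n x`
(`LaceExpansionIsingDeconvolutionParts.lean`), so `green4 = srwGreen 4 0` once the glue
`prob d n = convPow (srwStep d) n` announced in the header of `SRWReturnCounts.lean` lands;
(c) the continuous-time `CTWSAW.greenZero 4` of the weakly self-avoiding walk file
(`Barriers/CriticalPhenomena/WeaklySAWFourDimLogCorrections.lean`, jump rate `2d = 8`), for which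
`greenZero 4 = green4 / 8` by the tree's `CTWSAW.greenZero_eq_toReal`,
`greenLintegral_eq_greenSeries` and `greenSeries_eq_ofReal_tsum`
(`WeaklySAWCriticalNuLowerBound.lean`, `closedWords` form) read through
`SRW.card_finsetWalkLength_eq_count`;
(d) `∑' n, card ((zdGraph 4).finsetWalkLength n 0 0)/8^n` of `WeaklySAWReturnProbability.lean`
(`= green4` by `SRW.card_finsetWalkLength_eq_count`; its `one_le_tsum_prob_zero` duplicates
`one_le_green4`, its `tsum_prob_zero_le` bounds it by the lattice-Green integral).
-/

noncomputable section

open MeasureTheory Finset Real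

namespace Literature.Probability.LatticeModels

namespace SRW

variable {d : ℕ}

/-! ### Phases and orthogonality of characters on `[-π,π]^d` -/

/-- The phase `θ · x = Σⱼ θⱼ xⱼ` of a lattice point. Byte-for-byte the tree's
`Literature.Barriers.CriticalPhenomena.kdot` (`GaussianDominationRoute.lean`, `rfl`; kept here
because that file lives in the `Barriers` layer above this one — to be merged in the refactor) and
`rfl`-equal to Mathlib's `θ ⬝ᵥ (fun j => (x j : ℝ))` (`phase_eq_dotProduct`); it is the argument
of the cosine in the integrand of `latticeGreen`, and `-(2π)⁻¹ • phase · x = phaseFunctional x`.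
[folklore] -/
def phase (θ : Fin d → ℝ) (x : Site d) : ℝ := ∑ j, θ j * (x j : ℝ)

/-- `phase θ x` is Mathlib's dot product `θ ⬝ᵥ (↑x)`. [folklore] -/
theorem phase_eq_dotProduct (θ : Fin d → ℝ) (x : Site d) : phase θ x = θ ⬝ᵥ fun j => (x j : ℝ) := rfl

/-- The phase is additive in the lattice point. [folklore] -/
theorem phase_add (θ : Fin d → ℝ) (x y : Site d) : phase θ (x + y) = phase θ x + phase θ y := by
  simp only [phase, Pi.add_apply, Int.cast_add, mul_add, Finset.sum_add_distrib]

/-- The phase of a finite sum of lattice points. [folklore] -/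
theorem phase_sum {ι : Type*} (s : Finset ι) (θ : Fin d → ℝ) (f : ι → Site d) :
    phase θ (∑ i ∈ s, f i) = ∑ i ∈ s, phase θ (f i) := by
  classical
  induction s using Finset.induction_on with
  | empty => simp [phase]
  | insert a s ha ih => rw [Finset.sum_insert ha, phase_add, ih, Finset.sum_insert ha]

/-- The phase of a unit step is `±θⱼ`. [folklore] -/
theorem phase_stepVec (θ : Fin d → ℝ) (v : Dir d) :
    phase θ (stepVec v) = if v.2 then θ v.1 else -θ v.1 := by
  unfold phase
  simp_rw [stepVec_apply]
  rw [Finset.sum_eq_single v.1]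
  · cases v.2 <;> simp
  · intro j _ hj; simp [hj]
  · simp

/-- One-dimensional orthogonality: `∫_{-π}^{π} e^{i t n} dt = 2π [n = 0]` for `n ∈ ℤ`. [folklore] -/
theorem integral_Icc_cexp_mul_int (n : ℤ) :
    ∫ t in Set.Icc (-π) π, Complex.exp (Complex.I * t * n) = if n = 0 then ((2 * π : ℝ) : ℂ) else 0 := by
  rw [integral_Icc_eq_integral_Ioc, ← intervalIntegral.integral_of_le (by linarith [pi_pos])]
  split_ifs with hn
  · subst hn
    simp only [Int.cast_zero, mul_zero, Complex.exp_zero, intervalIntegral.integral_const]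
    simp; ring
  · have hc : (Complex.I * n : ℂ) ≠ 0 := mul_ne_zero Complex.I_ne_zero (by exact_mod_cast hn)
    have h : (fun t : ℝ => Complex.exp (Complex.I * t * n)) = fun t : ℝ => Complex.exp (Complex.I * n * t) := by
      funext t; ring_nf
    rw [h, integral_exp_mul_complex hc]
    have hper : Complex.exp (Complex.I * n * (π : ℝ)) = Complex.exp (Complex.I * n * (-π : ℝ)) := by
      rw [show Complex.I * n * ((π : ℝ) : ℂ) = Complex.I * n * ((-π : ℝ) : ℂ) + n * (2 * π * Complex.I) by
        push_cast; ring, Complex.exp_add, Complex.exp_int_mul_two_pi_mul_I, mul_one]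
    rw [hper, sub_self, zero_div]

/-- The Brillouin zone as a product of intervals (definitional). [folklore] -/
theorem brillouin_eq_pi : brillouin d = Set.pi Set.univ fun _ : Fin d => Set.Icc (-π) π := rfl

/-- Lebesgue measure restricted to `[-π,π]^d` is the product of the restricted measures.
[folklore] -/
theorem volume_restrict_brillouin :
    (volume : Measure (Fin d → ℝ)).restrict (brillouin d) =
      Measure.pi fun _ : Fin d => (volume : Measure ℝ).restrict (Set.Icc (-π) π) := by
  rw [brillouin_eq_pi, volume_pi, Measure.restrict_pi_pi]

/-- **Orthogonality of characters on `[-π,π]^d`**: `∫ e^{iθ·x} dθ = (2π)^d [x = 0]` for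
`x ∈ ℤ^d`. [folklore] -/
theorem integral_brillouin_cexp_phase (x : Site d) :
    ∫ θ in brillouin d, Complex.exp (Complex.I * phase θ x) =
      if x = 0 then (((2 * π : ℝ) : ℂ)) ^ d else 0 := by
  have hprod : ∀ θ : Fin d → ℝ, Complex.exp (Complex.I * phase θ x) =
      ∏ j, Complex.exp (Complex.I * θ j * (x j : ℤ)) := by
    intro θ
    rw [phase, Complex.ofReal_sum, Finset.mul_sum, Complex.exp_sum]
    refine Finset.prod_congr rfl fun j _ => ?_
    push_cast; ring_nf
  simp_rw [hprod]
  rw [volume_restrict_brillouin,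
    integral_fintype_prod_eq_prod (𝕜 := ℂ) (fun j (t : ℝ) => Complex.exp (Complex.I * t * (x j : ℤ)))]
  simp_rw [integral_Icc_cexp_mul_int]
  by_cases hx : x = 0
  · subst hx
    simp
  · rw [if_neg hx]
    obtain ⟨j, hj⟩ : ∃ j, x j ≠ 0 := by
      by_contra h
      push Not at h
      exact hx (funext h)
    exact Finset.prod_eq_zero (Finset.mem_univ j) (by rw [if_neg hj])

/-! ### The Fourier formula for the return counts -/

/-- The symbol of the walk: `Σ_v e^{iθ·e_v} = 2 Σⱼ cos θⱼ`. [folklore] -/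
theorem sum_dir_cexp_phase (θ : Fin d → ℝ) :
    ∑ v : Dir d, Complex.exp (Complex.I * phase θ (stepVec v)) = 2 * ∑ j, (Real.cos (θ j) : ℂ) := by
  rw [Fintype.sum_prod_type, Finset.mul_sum]
  refine Finset.sum_congr rfl fun j _ => ?_
  rw [Fintype.sum_bool, phase_stepVec, phase_stepVec]
  simp only [if_true, Bool.false_eq_true, if_false, Complex.ofReal_cos, Complex.two_cos]
  push_cast; ring_nf

/-- Expanding the `m`-th power of the symbol over step sequences:
`(Σ_v e^{iθ·e_v})^m = Σ_ω e^{iθ·ω(m)}`. [folklore] -/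
theorem pow_sum_dir_eq_sum_stepSeq (θ : Fin d → ℝ) (m : ℕ) :
    (∑ v : Dir d, Complex.exp (Complex.I * phase θ (stepVec v))) ^ m =
      ∑ ω : StepSeq d m, Complex.exp (Complex.I * phase θ (endpoint ω)) := by
  rw [Finset.sum_pow']
  rw [show (Fintype.piFinset fun _ : Fin m => (Finset.univ : Finset (Dir d))) = Finset.univ from
    Fintype.piFinset_univ]
  refine Finset.sum_congr rfl fun ω _ => ?_
  rw [← Complex.exp_sum, endpoint, phase_sum, Complex.ofReal_sum, Finset.mul_sum]

/-- **Fourier formula for the return count** (complex form):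
`∫_{[-π,π]^d} (2 Σⱼ cos θⱼ)^m dθ = (2π)^d · count d m 0`. [folklore] -/
theorem integral_brillouin_symbol_pow (m : ℕ) :
    ∫ θ in brillouin d, (2 * ∑ j, (Real.cos (θ j) : ℂ)) ^ m =
      (((2 * π : ℝ) : ℂ)) ^ d * (count d m 0 : ℕ) := by
  simp_rw [← sum_dir_cexp_phase, pow_sum_dir_eq_sum_stepSeq]
  rw [integral_finsetSum]
  · simp_rw [integral_brillouin_cexp_phase]
    rw [count_eq_sum_ite, Nat.cast_sum, Finset.mul_sum]
    refine Finset.sum_congr rfl fun ω _ => ?_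
    split_ifs <;> simp
  · intro ω _
    have hc : Continuous fun θ : Fin d → ℝ => Complex.exp (Complex.I * phase θ (endpoint ω)) := by
      unfold phase; fun_prop
    exact hc.continuousOn.integrableOn_compact (isCompact_brillouin d)

/-- **Fourier formula for the return count** (real form):
`count d m 0 = (2π)^{-d} ∫_{[-π,π]^d} (2 Σⱼ cos θⱼ)^m dθ`. [folklore] -/
theorem count_zero_eq_integral (m : ℕ) :
    (count d m 0 : ℝ) = ((2 * π) ^ d)⁻¹ * ∫ θ in brillouin d, (2 * ∑ j, Real.cos (θ j)) ^ m := by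
  have h := integral_brillouin_symbol_pow (d := d) m
  have hre : (∫ θ in brillouin d, (2 * ∑ j, (Real.cos (θ j) : ℂ)) ^ m) =
      ((∫ θ in brillouin d, (2 * ∑ j, Real.cos (θ j)) ^ m : ℝ) : ℂ) := by
    rw [← integral_complex_ofReal]
    refine integral_congr_ae (ae_of_all _ fun θ => ?_)
    push_cast; rfl
  rw [hre] at h
  have h' : (∫ θ in brillouin d, (2 * ∑ j, Real.cos (θ j)) ^ m) = (2 * π) ^ d * (count d m 0 : ℝ) := by
    exact_mod_cast h
  rw [h']
  have hπ : (2 * π) ^ d ≠ 0 := by positivity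
  field_simp

/-- **Fourier formula for the return probability**:
`pₘ(0) = (2π)^{-d} ∫_{[-π,π]^d} (d⁻¹ Σⱼ cos θⱼ)^m dθ` (`d ≥ 1`). [folklore] -/
theorem prob_eq_integral (hd : 0 < d) (m : ℕ) :
    prob d m 0 = ((2 * π) ^ d)⁻¹ * ∫ θ in brillouin d, ((d : ℝ)⁻¹ * ∑ j, Real.cos (θ j)) ^ m := by
  unfold prob
  rw [count_zero_eq_integral, mul_div_assoc, ← integral_div]
  congr 1
  refine integral_congr_ae (ae_of_all _ fun θ => ?_)
  have hd' : (d : ℝ) ≠ 0 := by exact_mod_cast hd.ne'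
  show (2 * ∑ j, Real.cos (θ j)) ^ m / (2 * d : ℝ) ^ m = ((d : ℝ)⁻¹ * ∑ j, Real.cos (θ j)) ^ m
  rw [← div_pow]
  congr 1
  field_simp

/-! ### Pointwise bound on the symbol -/

/-- … and at the antipode: `-cos t ≤ 1 - (2/π²)(π - |t|)²` on `[-π,π]`. [folklore] -/
theorem neg_cos_le_one_sub (t : ℝ) (ht : |t| ≤ π) : -Real.cos t ≤ 1 - 2 / π ^ 2 * (π - |t|) ^ 2 := by
  have h1 : -Real.cos t = Real.cos (π - |t|) := by
    rw [Real.cos_pi_sub, Real.cos_abs]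
  rw [h1]
  refine Real.cos_le_one_sub_mul_cos_sq ?_
  rw [abs_le]
  constructor <;> linarith [abs_nonneg t]

/-- **Pointwise bound on the Brillouin zone**:
`|d⁻¹ Σⱼ cos θⱼ|^m ≤ exp(-m c Σⱼ θⱼ²) + exp(-m c Σⱼ (π - |θⱼ|)²)`, `c = 2/(dπ²)` (`d ≥ 1`).
[folklore] -/
theorem abs_avg_cos_pow_le (hd : 0 < d) {θ : Fin d → ℝ} (hθ : θ ∈ brillouin d) (m : ℕ) :
    |(d : ℝ)⁻¹ * ∑ j, Real.cos (θ j)| ^ m ≤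
      Real.exp (-(m * (2 / (d * π ^ 2))) * ∑ j, θ j ^ 2) +
        Real.exp (-(m * (2 / (d * π ^ 2))) * ∑ j, (π - |θ j|) ^ 2) := by
  have hθj : ∀ j, |θ j| ≤ π := fun j => abs_le.2 (hθ j (Set.mem_univ _))
  have hd' : (0 : ℝ) < d := by exact_mod_cast hd
  have hdsum : (d : ℝ)⁻¹ * ∑ _j : Fin d, (1 : ℝ) = 1 := by
    rw [Finset.sum_const, Finset.card_univ, Fintype.card_fin, nsmul_eq_mul, mul_one]; field_simp
  set φ := (d : ℝ)⁻¹ * ∑ j, Real.cos (θ j) with hφ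
  set A := 2 / (d * π ^ 2) * ∑ j, θ j ^ 2 with hA
  set B := 2 / (d * π ^ 2) * ∑ j, (π - |θ j|) ^ 2 with hB
  have h1 : φ ≤ Real.exp (-A) := by
    have : φ ≤ 1 - A := by
      have hle : ∑ j, Real.cos (θ j) ≤ ∑ j, (1 - 2 / π ^ 2 * θ j ^ 2) :=
        Finset.sum_le_sum fun j _ => Real.cos_le_one_sub_mul_cos_sq (hθj j)
      calc φ ≤ (d : ℝ)⁻¹ * ∑ j, (1 - 2 / π ^ 2 * θ j ^ 2) := by
            rw [hφ]; exact mul_le_mul_of_nonneg_left hle (by positivity)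
        _ = 1 - A := by
            rw [Finset.sum_sub_distrib, mul_sub, hdsum, hA, ← Finset.mul_sum]
            ring
    exact this.trans (Real.one_sub_le_exp_neg A)
  have h2 : -φ ≤ Real.exp (-B) := by
    have : -φ ≤ 1 - B := by
      have hle : ∑ j, -Real.cos (θ j) ≤ ∑ j, (1 - 2 / π ^ 2 * (π - |θ j|) ^ 2) :=
        Finset.sum_le_sum fun j _ => neg_cos_le_one_sub _ (hθj j)
      calc -φ = (d : ℝ)⁻¹ * ∑ j, -Real.cos (θ j) := by
            rw [hφ, Finset.sum_neg_distrib]; ring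
        _ ≤ (d : ℝ)⁻¹ * ∑ j, (1 - 2 / π ^ 2 * (π - |θ j|) ^ 2) :=
            mul_le_mul_of_nonneg_left hle (by positivity)
        _ = 1 - B := by
            rw [Finset.sum_sub_distrib, mul_sub, hdsum, hB, ← Finset.mul_sum]
            ring
    exact this.trans (Real.one_sub_le_exp_neg B)
  have habs : |φ| ≤ max (Real.exp (-A)) (Real.exp (-B)) := by
    rw [abs_le]
    exact ⟨by linarith [le_max_right (Real.exp (-A)) (Real.exp (-B))],
      h1.trans (le_max_left _ _)⟩
  have hpow : |φ| ^ m ≤ (max (Real.exp (-A)) (Real.exp (-B))) ^ m :=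
    pow_le_pow_left₀ (abs_nonneg _) habs m
  have hmA : Real.exp (-(m * (2 / (d * π ^ 2))) * ∑ j, θ j ^ 2) = Real.exp (-A) ^ m := by
    rw [← Real.exp_nat_mul, hA]; ring_nf
  have hmB : Real.exp (-(m * (2 / (d * π ^ 2))) * ∑ j, (π - |θ j|) ^ 2) = Real.exp (-B) ^ m := by
    rw [← Real.exp_nat_mul, hB]; ring_nf
  rw [hmA, hmB]
  refine hpow.trans ?_
  rcases max_cases (Real.exp (-A)) (Real.exp (-B)) with ⟨h, _⟩ | ⟨h, _⟩
  · rw [h]; linarith [pow_nonneg (Real.exp_pos (-B)).le m]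
  · rw [h]; linarith [pow_nonneg (Real.exp_pos (-A)).le m]

/-! ### Gaussian integrals over the Brillouin zone -/

/-- `∫_{[-π,π]^d} e^{-a Σ θⱼ²} dθ ≤ (π/a)^{d/2}` for `a > 0`. [folklore] -/
theorem integral_brillouin_exp_neg_mul_sum_sq_le {a : ℝ} (ha : 0 < a) :
    ∫ θ in brillouin d, Real.exp (-a * ∑ j, θ j ^ 2) ≤ Real.sqrt (π / a) ^ d := by
  have hprod : ∀ θ : Fin d → ℝ, Real.exp (-a * ∑ j, θ j ^ 2) = ∏ j, Real.exp (-a * θ j ^ 2) := by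
    intro θ; rw [Finset.mul_sum, Real.exp_sum]
  simp_rw [hprod]
  have hint : Integrable (fun θ : Fin d → ℝ => ∏ j, Real.exp (-a * θ j ^ 2)) volume := by
    rw [volume_pi]
    exact Integrable.fintype_prod (f := fun _ t => Real.exp (-a * t ^ 2))
      (fun _ => integrable_exp_neg_mul_sq ha)
  calc ∫ θ in brillouin d, ∏ j, Real.exp (-a * θ j ^ 2)
      ≤ ∫ θ : Fin d → ℝ, ∏ j, Real.exp (-a * θ j ^ 2) :=
        setIntegral_le_integral hint (ae_of_all _ fun θ =>
          Finset.prod_nonneg fun j _ => (Real.exp_pos _).le)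
    _ = (∫ t : ℝ, Real.exp (-a * t ^ 2)) ^ d := by
        rw [volume_pi, integral_fintype_prod_eq_pow (f := fun t : ℝ => Real.exp (-a * t ^ 2))]
        simp
    _ = Real.sqrt (π / a) ^ d := by rw [integral_gaussian]

/-- The one-dimensional antipodal Gaussian: `t ↦ e^{-a(π - |t|)²}` is integrable on `ℝ` …
[folklore] -/
theorem integrable_exp_neg_mul_pi_sub_abs_sq {a : ℝ} (ha : 0 < a) :
    Integrable (fun t : ℝ => Real.exp (-a * (π - |t|) ^ 2)) volume := by
  have h1 : Integrable (fun t : ℝ => Real.exp (-a * (π - t) ^ 2)) volume :=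
    (integrable_exp_neg_mul_sq ha).comp_sub_left π
  have h2 : Integrable (fun t : ℝ => Real.exp (-a * (π + t) ^ 2)) volume :=
    (integrable_exp_neg_mul_sq ha).comp_add_left π
  refine (h1.add h2).mono' (by fun_prop) (ae_of_all _ fun t => ?_)
  rw [Real.norm_eq_abs, abs_of_nonneg (Real.exp_pos _).le]
  rcases le_total 0 t with ht | ht
  · rw [abs_of_nonneg ht]
    simp only [Pi.add_apply]
    linarith [Real.exp_pos (-a * (π + t) ^ 2)]
  · rw [abs_of_nonpos ht, sub_neg_eq_add]
    simp only [Pi.add_apply]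
    linarith [Real.exp_pos (-a * (π - t) ^ 2)]

/-- … with `∫_ℝ e^{-a(π - |t|)²} dt ≤ 2 (π/a)^{1/2}`. [folklore] -/
theorem integral_exp_neg_mul_pi_sub_abs_sq_le {a : ℝ} (ha : 0 < a) :
    ∫ t : ℝ, Real.exp (-a * (π - |t|) ^ 2) ≤ 2 * Real.sqrt (π / a) := by
  have h1 : Integrable (fun t : ℝ => Real.exp (-a * (π - t) ^ 2)) volume :=
    (integrable_exp_neg_mul_sq ha).comp_sub_left π
  have h2 : Integrable (fun t : ℝ => Real.exp (-a * (π + t) ^ 2)) volume :=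
    (integrable_exp_neg_mul_sq ha).comp_add_left π
  have hle : ∀ t : ℝ, Real.exp (-a * (π - |t|) ^ 2) ≤
      Real.exp (-a * (π - t) ^ 2) + Real.exp (-a * (π + t) ^ 2) := by
    intro t
    rcases le_total 0 t with ht | ht
    · rw [abs_of_nonneg ht]; linarith [Real.exp_pos (-a * (π + t) ^ 2)]
    · rw [abs_of_nonpos ht, sub_neg_eq_add]; linarith [Real.exp_pos (-a * (π - t) ^ 2)]
  calc ∫ t : ℝ, Real.exp (-a * (π - |t|) ^ 2)
      ≤ ∫ t : ℝ, (Real.exp (-a * (π - t) ^ 2) + Real.exp (-a * (π + t) ^ 2)) :=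
        integral_mono (integrable_exp_neg_mul_pi_sub_abs_sq ha) (h1.add h2) hle
    _ = (∫ t : ℝ, Real.exp (-a * (π - t) ^ 2)) + ∫ t : ℝ, Real.exp (-a * (π + t) ^ 2) :=
        integral_add h1 h2
    _ = 2 * Real.sqrt (π / a) := by
        rw [integral_sub_left_eq_self (fun t => Real.exp (-a * t ^ 2)) volume π,
          integral_add_left_eq_self (fun t => Real.exp (-a * t ^ 2)) π, integral_gaussian]
        ring

/-- `∫_{[-π,π]^d} e^{-a Σ (π - |θⱼ|)²} dθ ≤ (2 (π/a)^{1/2})^d` for `a > 0`. [folklore] -/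
theorem integral_brillouin_exp_neg_mul_sum_pi_sub_abs_sq_le {a : ℝ} (ha : 0 < a) :
    ∫ θ in brillouin d, Real.exp (-a * ∑ j, (π - |θ j|) ^ 2) ≤ (2 * Real.sqrt (π / a)) ^ d := by
  have hprod : ∀ θ : Fin d → ℝ, Real.exp (-a * ∑ j, (π - |θ j|) ^ 2) =
      ∏ j, Real.exp (-a * (π - |θ j|) ^ 2) := by
    intro θ; rw [Finset.mul_sum, Real.exp_sum]
  simp_rw [hprod]
  have hint : Integrable (fun θ : Fin d → ℝ => ∏ j, Real.exp (-a * (π - |θ j|) ^ 2)) volume := by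
    rw [volume_pi]
    exact Integrable.fintype_prod (f := fun _ t => Real.exp (-a * (π - |t|) ^ 2))
      (fun _ => integrable_exp_neg_mul_pi_sub_abs_sq ha)
  calc ∫ θ in brillouin d, ∏ j, Real.exp (-a * (π - |θ j|) ^ 2)
      ≤ ∫ θ : Fin d → ℝ, ∏ j, Real.exp (-a * (π - |θ j|) ^ 2) :=
        setIntegral_le_integral hint (ae_of_all _ fun θ =>
          Finset.prod_nonneg fun j _ => (Real.exp_pos _).le)
    _ = (∫ t : ℝ, Real.exp (-a * (π - |t|) ^ 2)) ^ d := by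
        rw [volume_pi, integral_fintype_prod_eq_pow (f := fun t : ℝ => Real.exp (-a * (π - |t|) ^ 2))]
        simp
    _ ≤ (2 * Real.sqrt (π / a)) ^ d :=
        pow_le_pow_left₀ (integral_nonneg fun t => (Real.exp_pos _).le)
          (integral_exp_neg_mul_pi_sub_abs_sq_le ha) d

/-! ### The heat-kernel bound -/

variable (d) in
/-- The constant `C_d = (2π)^{-d} (1 + 2^d) (dπ³/2)^{d/2}` of the return-probability bound.
[folklore] -/
def retConst : ℝ := ((2 * π) ^ d)⁻¹ * (1 + 2 ^ d) * Real.sqrt (d * π ^ 3 / 2) ^ d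

/-- `C_d > 0`. [folklore] -/
theorem retConst_pos (hd : 0 < d) : 0 < retConst d := by
  unfold retConst
  have : (0 : ℝ) < d := by exact_mod_cast hd
  positivity

/-- **On-diagonal heat-kernel bound for the simple random walk on `ℤ^d`**:
`pₘ(0) ≤ C_d m^{-d/2}` for `m ≥ 1`, written with `(√m)⁻¹ ^ d`. (Prior art in the tree, other
encodings: `LongRangePhi4.exists_srwLaw_le_rpow` — all `x`, non-explicit `K` — and
`lazyLaw_zero_le`, `RigorousRGSmallParameterLazyWalk.lean`; see the module docstring.) [folklore] -/
theorem prob_le_inv_sqrt_pow (hd : 0 < d) {m : ℕ} (hm : 1 ≤ m) :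
    prob d m 0 ≤ retConst d * (Real.sqrt m)⁻¹ ^ d := by
  have hd' : (0 : ℝ) < d := by exact_mod_cast hd
  have hm' : (0 : ℝ) < m := by exact_mod_cast hm
  set c : ℝ := 2 / (d * π ^ 2) with hc
  have hcpos : 0 < c := by positivity
  set a : ℝ := m * c with ha
  have hapos : 0 < a := by positivity
  -- integrability of the three integrands on the (compact) Brillouin zone
  have hK := isCompact_brillouin d
  have hi0 : IntegrableOn (fun θ : Fin d → ℝ => ((d : ℝ)⁻¹ * ∑ j, Real.cos (θ j)) ^ m)
      (brillouin d) volume :=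
    (by fun_prop : Continuous fun θ : Fin d → ℝ => ((d : ℝ)⁻¹ * ∑ j, Real.cos (θ j)) ^ m)
      |>.continuousOn.integrableOn_compact hK
  have hi1 : IntegrableOn (fun θ : Fin d → ℝ => |(d : ℝ)⁻¹ * ∑ j, Real.cos (θ j)| ^ m)
      (brillouin d) volume :=
    (by fun_prop : Continuous fun θ : Fin d → ℝ => |(d : ℝ)⁻¹ * ∑ j, Real.cos (θ j)| ^ m)
      |>.continuousOn.integrableOn_compact hK
  have hi2 : IntegrableOn (fun θ : Fin d → ℝ => Real.exp (-a * ∑ j, θ j ^ 2) +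
      Real.exp (-a * ∑ j, (π - |θ j|) ^ 2)) (brillouin d) volume :=
    (by fun_prop : Continuous fun θ : Fin d → ℝ => Real.exp (-a * ∑ j, θ j ^ 2) +
      Real.exp (-a * ∑ j, (π - |θ j|) ^ 2)) |>.continuousOn.integrableOn_compact hK
  have hI : ∫ θ in brillouin d, ((d : ℝ)⁻¹ * ∑ j, Real.cos (θ j)) ^ m ≤
      (1 + 2 ^ d) * Real.sqrt (π / a) ^ d := by
    calc ∫ θ in brillouin d, ((d : ℝ)⁻¹ * ∑ j, Real.cos (θ j)) ^ m
        ≤ ∫ θ in brillouin d, |(d : ℝ)⁻¹ * ∑ j, Real.cos (θ j)| ^ m :=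
          setIntegral_mono_on hi0 hi1 (measurableSet_brillouin d) fun θ _ => by
            rw [← abs_pow]; exact le_abs_self _
      _ ≤ ∫ θ in brillouin d, (Real.exp (-a * ∑ j, θ j ^ 2) +
            Real.exp (-a * ∑ j, (π - |θ j|) ^ 2)) :=
          setIntegral_mono_on hi1 hi2 (measurableSet_brillouin d) fun θ hθ => by
            have := abs_avg_cos_pow_le hd hθ m
            rw [ha, hc]
            convert this using 3
      _ = (∫ θ in brillouin d, Real.exp (-a * ∑ j, θ j ^ 2)) +
            ∫ θ in brillouin d, Real.exp (-a * ∑ j, (π - |θ j|) ^ 2) := by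
          refine integral_add ?_ ?_
          · exact (by fun_prop : Continuous fun θ : Fin d → ℝ => Real.exp (-a * ∑ j, θ j ^ 2))
              |>.continuousOn.integrableOn_compact hK
          · exact (by fun_prop : Continuous fun θ : Fin d → ℝ =>
              Real.exp (-a * ∑ j, (π - |θ j|) ^ 2)) |>.continuousOn.integrableOn_compact hK
      _ ≤ Real.sqrt (π / a) ^ d + (2 * Real.sqrt (π / a)) ^ d :=
          add_le_add (integral_brillouin_exp_neg_mul_sum_sq_le hapos)
            (integral_brillouin_exp_neg_mul_sum_pi_sub_abs_sq_le hapos)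
      _ = (1 + 2 ^ d) * Real.sqrt (π / a) ^ d := by rw [mul_pow]; ring
  have hsqrt : Real.sqrt (π / a) = Real.sqrt (d * π ^ 3 / 2) * (Real.sqrt m)⁻¹ := by
    rw [ha, hc, ← Real.sqrt_inv, ← Real.sqrt_mul (by positivity)]
    congr 1
    field_simp
  rw [prob_eq_integral hd, retConst]
  have h2π : (0 : ℝ) < ((2 * π) ^ d)⁻¹ := by positivity
  calc ((2 * π) ^ d)⁻¹ * ∫ θ in brillouin d, ((d : ℝ)⁻¹ * ∑ j, Real.cos (θ j)) ^ m
      ≤ ((2 * π) ^ d)⁻¹ * ((1 + 2 ^ d) * Real.sqrt (π / a) ^ d) :=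
        mul_le_mul_of_nonneg_left hI h2π.le
    _ = ((2 * π) ^ d)⁻¹ * (1 + 2 ^ d) * Real.sqrt (d * π ^ 3 / 2) ^ d * (Real.sqrt m)⁻¹ ^ d := by
        rw [hsqrt, mul_pow]; ring

/-! ### Dimension four: `pₘ(x) ≤ C/m²`, the Green function and its tails -/

/-- `(√m)⁻¹⁴ = 1/m²`. [folklore] -/
theorem inv_sqrt_pow_four (m : ℕ) : (Real.sqrt m)⁻¹ ^ 4 = ((m : ℝ) ^ 2)⁻¹ := by
  rw [inv_pow, show (4 : ℕ) = 2 * 2 from rfl, pow_mul, Real.sq_sqrt (Nat.cast_nonneg m)]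

/-- `pₘ(0) ≤ C₄/m²` on `ℤ⁴`, `m ≥ 1`. [folklore] -/
theorem prob_four_zero_le {m : ℕ} (hm : 1 ≤ m) : prob 4 m 0 ≤ retConst 4 / (m : ℝ) ^ 2 := by
  have h := prob_le_inv_sqrt_pow (d := 4) (by norm_num) hm
  rwa [inv_sqrt_pow_four, ← div_eq_mul_inv] at h

/-- The constant of the uniform bound, `C₄' = max(1, 4C₄)`. (Numerically `C₄ = 17π²/4 ≈ 41.9`,
so the `max 1` is redundant; it is kept only to make `1 ≤ C₄'` free of a numeric lemma on `π`.)
[folklore] -/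
def retConst4 : ℝ := max 1 (4 * retConst 4)

/-- `C₄' ≥ 1 > 0`. [folklore] -/
theorem one_le_retConst4 : 1 ≤ retConst4 := le_max_left _ _

/-- **Uniform heat-kernel bound on `ℤ⁴`**: `pₘ(x) ≤ C₄'/m²` for all `x` and `m ≥ 1` (maximum
principle + monotonicity reduce to the on-diagonal bound at the even time `2⌊m/2⌋`). [folklore] -/
theorem prob_four_le {m : ℕ} (hm : 1 ≤ m) (x : Site 4) : prob 4 m x ≤ retConst4 / (m : ℝ) ^ 2 := by
  rcases Nat.lt_or_ge m 2 with h1 | h2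
  · have hm1 : m = 1 := by omega
    subst hm1
    calc prob 4 1 x ≤ 1 := prob_le_one (by norm_num) 1 x
      _ ≤ retConst4 / ((1 : ℕ) : ℝ) ^ 2 := by simpa using one_le_retConst4
  · set k := m / 2 with hk
    have hk1 : 1 ≤ k := by omega
    have h2k : 2 * k ≤ m := by omega
    have hmk : (m : ℝ) ≤ 2 * (k + k : ℕ) := by
      have : m ≤ 2 * (k + k) := by omega
      exact_mod_cast this
    have hkpos : (0 : ℝ) < (k + k : ℕ) := by
      have : 0 < k + k := by omega
      exact_mod_cast this
    calc prob 4 m x ≤ prob 4 (k + k) 0 := prob_le_prob_even (by norm_num) h2k x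
      _ ≤ retConst 4 / ((k + k : ℕ) : ℝ) ^ 2 := prob_four_zero_le (by omega)
      _ ≤ 4 * retConst 4 / (m : ℝ) ^ 2 := by
          rw [div_le_div_iff₀ (by positivity) (by positivity)]
          have hC := (retConst_pos (d := 4) (by norm_num)).le
          calc retConst 4 * (m : ℝ) ^ 2 ≤ retConst 4 * (2 * ((k + k : ℕ) : ℝ)) ^ 2 := by
                gcongr
            _ = 4 * retConst 4 * ((k + k : ℕ) : ℝ) ^ 2 := by ring
      _ ≤ retConst4 / (m : ℝ) ^ 2 :=
          div_le_div_of_nonneg_right (le_max_right _ _) (by positivity)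

/-- The return probabilities on `ℤ⁴` are summable (transience, quantitatively). [folklore] -/
theorem summable_prob_four_zero : Summable fun m => prob 4 m 0 := by
  rw [← summable_nat_add_iff 1]
  refine Summable.of_nonneg_of_le (fun m => prob_nonneg _ _)
    (fun m => prob_four_zero_le (m := m + 1) (by omega)) ?_
  have h : Summable fun m : ℕ => retConst 4 * (1 / ((m + 1 : ℕ) : ℝ) ^ 2) := by
    refine Summable.mul_left _ ?_
    have := (summable_nat_add_iff (f := fun m : ℕ => 1 / (m : ℝ) ^ 2) 1).2
      (Real.summable_one_div_nat_pow.2 one_lt_two)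
    simpa using this
  refine h.congr fun m => ?_
  rw [mul_one_div]

/-- The Green function of the simple random walk on `ℤ⁴` at the origin,
`G = Σ_{m ≥ 0} pₘ(0) = Σₙ P(Sₙ = 0)` (expected number of visits to `0`, time `0` included).
**Other encodings of the same number in the tree** (see the module docstring):
`green4 = 4 * latticeGreen (0 : Site 4)` (`LatticeGreenFunction.lean`; identification deferred to a
Fourier-inversion glue lemma), `green4 = SpreadOutIsing.srwGreen 4 0`
(`LaceExpansionIsingDeconvolutionParts.lean`; after the `prob = convPow (srwStep d)` glue of
`SRWReturnCounts.lean`), `CTWSAW.greenZero 4 = green4 / 8` (continuous time at jump rate `8`,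
`WeaklySAWFourDimLogCorrections.lean`; via the tree's `CTWSAW.greenZero_eq_toReal`,
`greenLintegral_eq_greenSeries`, `greenSeries_eq_ofReal_tsum` of `WeaklySAWCriticalNuLowerBound.lean`),
and `∑' n, card ((zdGraph 4).finsetWalkLength n 0 0)/8^n` of `WeaklySAWReturnProbability.lean`
(equal term by term by `SRW.card_finsetWalkLength_eq_count`; `one_le_tsum_prob_zero` there is
`one_le_green4` here). Only `d = 4` is needed downstream; the bounds below are what the users
consume. [folklore] -/
def green4 : ℝ := ∑' m, prob 4 m 0

/-- `G ≥ 1` (the visit at time `0`). [folklore] -/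
theorem one_le_green4 : 1 ≤ green4 := by
  unfold green4
  have h := summable_prob_four_zero.sum_le_tsum (Finset.range 1) (fun m _ => prob_nonneg m 0)
  simpa [prob_zero] using h

/-- `G > 0`. [folklore] -/
theorem green4_pos : 0 < green4 := lt_of_lt_of_le one_pos one_le_green4

/-- Partial Green function `Gₙ = Σ_{m ≤ n} pₘ(0)` (partial sums of `green4`; same remarks on
encodings apply). [folklore] -/
def green4Partial (n : ℕ) : ℝ := ∑ m ∈ Finset.range (n + 1), prob 4 m 0

/-- `Gₙ ≤ G`. [folklore] -/
theorem green4Partial_le (n : ℕ) : green4Partial n ≤ green4 :=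
  summable_prob_four_zero.sum_le_tsum _ (fun m _ => prob_nonneg m 0)

/-- `G - Gₙ = Σ_{m > n} pₘ(0)`, the tail. [folklore] -/
theorem green4_sub_partial (n : ℕ) : green4 - green4Partial n = ∑' m, prob 4 (m + (n + 1)) 0 := by
  unfold green4 green4Partial
  rw [← summable_prob_four_zero.sum_add_tsum_nat_add (n + 1)]
  ring

/-- The telescoping series `Σ_m (1/(m+n) - 1/(m+n+1)) = 1/n` (`n ≥ 1`). [folklore] -/
theorem hasSum_telescope {n : ℕ} (hn : 1 ≤ n) :
    HasSum (fun m : ℕ => 1 / ((m + n : ℕ) : ℝ) - 1 / ((m + n + 1 : ℕ) : ℝ)) (1 / (n : ℝ)) := by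
  have hnn : ∀ m : ℕ, 0 ≤ 1 / ((m + n : ℕ) : ℝ) - 1 / ((m + n + 1 : ℕ) : ℝ) := by
    intro m
    rw [sub_nonneg]
    exact one_div_le_one_div_of_le (by positivity) (by push_cast; linarith)
  rw [hasSum_iff_tendsto_nat_of_nonneg hnn]
  have hpartial : ∀ N : ℕ, ∑ m ∈ Finset.range N, (1 / ((m + n : ℕ) : ℝ) - 1 / ((m + n + 1 : ℕ) : ℝ)) =
      1 / (n : ℝ) - 1 / ((N + n : ℕ) : ℝ) := by
    intro N
    induction N with
    | zero => simp
    | succ N ih =>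
        rw [Finset.sum_range_succ, ih]
        have : ((N + 1 + n : ℕ) : ℝ) = ((N + n + 1 : ℕ) : ℝ) := by push_cast; ring
        rw [this]; ring
  simp_rw [hpartial]
  have h0 : Filter.Tendsto (fun N : ℕ => 1 / ((N + n : ℕ) : ℝ)) Filter.atTop (nhds 0) := by
    have h := (tendsto_one_div_add_atTop_nhds_zero_nat (𝕜 := ℝ)).comp (Filter.tendsto_add_atTop_nat (n - 1))
    refine h.congr fun N => ?_
    simp only [Function.comp_apply]
    congr 1
    push_cast
    have : ((n - 1 : ℕ) : ℝ) = n - 1 := by rw [Nat.cast_sub hn, Nat.cast_one]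
    rw [this]; ring
  simpa using (tendsto_const_nhds (x := 1 / (n : ℝ))).sub h0

/-- **Tail of the Green function on `ℤ⁴`**: `Σ_{m > n} pₘ(0) ≤ C₄/n` for `n ≥ 1`. [folklore] -/
theorem green4_tail_le {n : ℕ} (hn : 1 ≤ n) : ∑' m, prob 4 (m + (n + 1)) 0 ≤ retConst 4 / n := by
  have hC := (retConst_pos (d := 4) (by norm_num)).le
  have hsum1 : Summable fun m => prob 4 (m + (n + 1)) 0 :=
    (summable_nat_add_iff (f := fun m => prob 4 m 0) (n + 1)).2 summable_prob_four_zero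
  have htel := hasSum_telescope hn
  have hle : ∀ m : ℕ, prob 4 (m + (n + 1)) 0 ≤
      retConst 4 * (1 / ((m + n : ℕ) : ℝ) - 1 / ((m + n + 1 : ℕ) : ℝ)) := by
    intro m
    refine (prob_four_zero_le (m := m + (n + 1)) (by omega)).trans ?_
    have hmn : (0 : ℝ) < ((m + n : ℕ) : ℝ) := by
      have : 0 < m + n := by omega
      exact_mod_cast this
    have hmn1 : (0 : ℝ) < ((m + n + 1 : ℕ) : ℝ) := by positivity
    rw [div_eq_mul_one_div]
    refine mul_le_mul_of_nonneg_left ?_ hC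
    rw [div_sub_div _ _ hmn.ne' hmn1.ne', one_mul, mul_one,
      div_le_div_iff₀ (by positivity) (mul_pos hmn hmn1)]
    have : ((m + (n + 1) : ℕ) : ℝ) = ((m + n + 1 : ℕ) : ℝ) := by push_cast; ring
    rw [this]
    push_cast
    nlinarith
  calc ∑' m, prob 4 (m + (n + 1)) 0
      ≤ ∑' m, retConst 4 * (1 / ((m + n : ℕ) : ℝ) - 1 / ((m + n + 1 : ℕ) : ℝ)) :=
        hsum1.tsum_le_tsum hle (htel.mul_left _).summable
    _ = retConst 4 * (1 / (n : ℝ)) := (htel.mul_left _).tsum_eq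
    _ = retConst 4 / n := by rw [mul_one_div]

/-- **`G - Gₙ ≤ C₄/n`** (`n ≥ 1`). [folklore] -/
theorem green4_sub_partial_le {n : ℕ} (hn : 1 ≤ n) : green4 - green4Partial n ≤ retConst 4 / n := by
  rw [green4_sub_partial]
  exact green4_tail_le hn

end SRW

end Literature.Probability.LatticeModels
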